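import Mathlib
import Summits.Ventures.LatticeQCDFlow.Scaling.U1TorusHaar
import Summits.Ventures.LatticeQCDFlow.Scaling.TorusCubeGeometry

/-!
# LatticeQCDFlow / Scaling — `U(1)` on the torus: the atomic Haar moments of two stacked
# plaquette cosines against one, two or three other plaquettes

HONEST FRAMING: exact (Metropolis-corrected) sampling algorithms for lattice gauge theory;
figures of merit are autocorrelation/cost numbers at stated couplings and volumes; no
continuum-physics claim.

Venture `LatticeQCDFlow` (cell pub-lqcd), topic `Scaling`, FANOUT row 30 (lean-1) — OUR WORK, the
lattice half of the leading-coefficient identity (LC) of theory2 item 120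
(HOME/lean/theory2/LANDING.md §32), part 1.  `ν = zdHaar d Circle`, `X = Re U_top`, `Y = Re U_bot`
for the stacked genuine plaquettes `top i j = (0;i,j)`, `bot i j a = (−e_a;i,j)` of
`Scaling/TorusCubeGeometry.lean`, `c_q = Re U_q` (`cosT`), torus side `L ≥ 3`.

* `cosT_mulSingle_of_not_mem` — `c_r` ignores the bond variables off `r`;
  `exists_sign_holT_mulSingle` — every bond of a genuine `q` multiplies `U_q` by `z^{±1}`;
  `integral_mul_cosT_pow` — PEELING `c_q^m` through any bond of `q` private to the weight;
  `exists_bond_not_mem_three` — a genuine label keeps a bond outside any three other genuine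
  labels (`4 > 1 + 1 + 1`, `TorusPlaquetteGeometry.card_inter_tbonds_le_one`).
* THE ATOMIC MOMENTS (`m_k = ∫ (Re z)^k dHaar`: `1, 0, 1/2, 0, 3/8`):
  `integral_X_pow_mul_Y_pow` — `E[XᵅYᵝ] = m_α m_β`;
  `integral_XY_pow_mul_cosT` — `E[XᵅYᵝ c_q] = 0` for genuine `q ∉ {top, bot}`;
  `integral_XY_pow_mul_cosT_sq` — `E[XᵅYᵝ c_q²] = m_α m_β / 2`;
  `integral_XY_pow_mul_cosT_mul_cosT` — `E[XᵅYᵝ c_q c_r] = 0` for `q ≠ r`;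
  `integral_mul_X_eq_zero` / `integral_three_mul_X` (and the `Y` versions) — `E[H · X] = 0` for
  every bounded weight `H` built from `Y` and at most three other genuine plaquettes (one bond of
  `top` stays uncovered and is peeled); `integral_cosT_pow` — `E[c_q^m] = m_m`.
Elementary; nothing is cited as a fact; no `def`, no `sorry`.
-/

noncomputable section

open MeasureTheory Filter Topology Finset
open Literature.MathematicalPhysics.QuantumFieldTheory
open Summit.Ventures.LatticeQCDFlow.Theory2.Lattice.TorusGeom

namespace Summit.Ventures.LatticeQCDFlow.Theory2.Lattice.U1Torus

variable {d L : ℕ}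

/-! ## §1. Invariance, signs, peeling, uncovered bonds -/

/-- `c_r` does not depend on a bond variable off `r`. [folklore] -/
theorem cosT_mulSingle_of_not_mem [NeZero L] {r : TPlaq d L} {b : Edge d L} (hb : b ∉ r.tbonds)
    (z : Circle) (U : ZdGaugeConfig d Circle) :
    cosT L r (Pi.mulSingle (torusSect L b) z * U) = cosT L r U := by
  have hne : ∀ b' ∈ r.tbonds, torusSect L b' ≠ torusSect L b := fun b' hb' h =>
    hb (torusSect_injective h ▸ hb')
  unfold cosT
  rw [holT_mulSingle_of_forall_ne (hne _ (by simp [TPlaq.tbonds])) (hne _ (by simp [TPlaq.tbonds]))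
    (hne _ (by simp [TPlaq.tbonds])) (hne _ (by simp [TPlaq.tbonds]))]

/-- **Every bond of a genuine label multiplies its holonomy by `z` or by `z⁻¹`.** [folklore] -/
theorem exists_sign_holT_mulSingle [NeZero L] (hL : 2 ≤ L) {q : TPlaq d L} (hq : q.2.1 < q.2.2)
    {b : Edge d L} (hb : b ∈ q.tbonds) :
    ∃ ε : ℤ, (ε = 1 ∨ ε = -1) ∧ ∀ (z : Circle) (U : ZdGaugeConfig d Circle),
      holT L q (Pi.mulSingle (torusSect L b) z * U) = z ^ ε * holT L q U := by
  obtain ⟨x, k, l⟩ := q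
  have hne := tbonds_pairwise_ne hL (x := x) (Fin.ne_of_lt hq)
  obtain ⟨n12, n13, n14, n23, n24, n34⟩ := hne
  rw [mem_tbonds_iff] at hb
  rcases hb with rfl | rfl | rfl | rfl
  · exact ⟨1, Or.inl rfl, fun z U => by
      rw [zpow_one]; exact holT_mulSingle_eq_mul_of_fst n12.symm n13.symm n14.symm z U⟩
  · exact ⟨1, Or.inl rfl, fun z U => by
      rw [zpow_one]; exact holT_mulSingle_eq_mul_of_snd n12 n23.symm n24.symm z U⟩
  · exact ⟨-1, Or.inr rfl, fun z U => by
      rw [zpow_neg, zpow_one]; exact holT_mulSingle_eq_inv_mul_of_thd n13 n23 n34.symm z U⟩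
  · exact ⟨-1, Or.inr rfl, fun z U => by
      rw [zpow_neg, zpow_one]; exact holT_mulSingle_eq_inv_mul_of_fth n14 n24 n34 z U⟩

/-- **PEELING `c_q^m`**: if the bounded measurable weight `G` ignores a bond `b` of the genuine label
`q`, then `∫ G · c_q^m dν = (∫ G dν) · ∫ (Re z)^m dHaar`. [folklore] -/
theorem integral_mul_cosT_pow [NeZero L] (hL : 2 ≤ L) {q : TPlaq d L} (hq : q.2.1 < q.2.2)
    {b : Edge d L} (hb : b ∈ q.tbonds) {G : ZdGaugeConfig d Circle → ℝ} (hGm : Measurable G) {K : ℝ}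
    (hGb : ∀ U, ‖G U‖ ≤ K) (hGinv : ∀ z U, G (Pi.mulSingle (torusSect L b) z * U) = G U) (m : ℕ) :
    ∫ U, G U * cosT L q U ^ m ∂(zdHaar d Circle) =
      (∫ U, G U ∂(zdHaar d Circle)) * ∫ z, ((z : ℂ).re) ^ m ∂(haarProbability Circle) := by
  obtain ⟨ε, hε, hhol⟩ := exists_sign_holT_mulSingle hL hq hb
  have hf : Continuous fun z : Circle => ((z : ℂ).re) ^ m :=
    (Complex.continuous_re.comp continuous_subtype_val).pow m
  exact integral_mul_comp_holT_eq_mul_integral q (torusSect L b) hε hhol hGm hGb hGinv hf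

/-- **A genuine label keeps a bond outside any three other genuine labels** (each of them contains at
most one of its four bonds). [folklore] -/
theorem exists_bond_not_mem_three (hL : 3 ≤ L) {p r₁ r₂ r₃ : TPlaq d L} (hp : p.2.1 < p.2.2)
    (h₁ : r₁.2.1 < r₁.2.2) (h₂ : r₂.2.1 < r₂.2.2) (h₃ : r₃.2.1 < r₃.2.2) (n₁ : r₁ ≠ p) (n₂ : r₂ ≠ p)
    (n₃ : r₃ ≠ p) : ∃ b ∈ p.tbonds, b ∉ r₁.tbonds ∧ b ∉ r₂.tbonds ∧ b ∉ r₃.tbonds := by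
  by_contra h
  push Not at h
  have hsub : p.tbonds ⊆ (p.tbonds ∩ r₁.tbonds) ∪ (p.tbonds ∩ r₂.tbonds) ∪ (p.tbonds ∩ r₃.tbonds) := by
    intro b hb
    simp only [Finset.mem_union, Finset.mem_inter]
    by_cases h1 : b ∈ r₁.tbonds
    · exact Or.inl (Or.inl ⟨hb, h1⟩)
    by_cases h2 : b ∈ r₂.tbonds
    · exact Or.inl (Or.inr ⟨hb, h2⟩)
    exact Or.inr ⟨hb, h b hb h1 h2⟩
  have c1 := card_inter_tbonds_le_one hL hp h₁ n₁.symm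
  have c2 := card_inter_tbonds_le_one hL hp h₂ n₂.symm
  have c3 := card_inter_tbonds_le_one hL hp h₃ n₃.symm
  have c4 := card_tbonds (by omega : 2 ≤ L) hp
  have h5 := Finset.card_le_card hsub
  have h6 := Finset.card_union_le (p.tbonds ∩ r₁.tbonds ∪ p.tbonds ∩ r₂.tbonds) (p.tbonds ∩ r₃.tbonds)
  have h7 := Finset.card_union_le (p.tbonds ∩ r₁.tbonds) (p.tbonds ∩ r₂.tbonds)
  omega

/-! ## §2. The atomic moments -/

section Atomic

variable [NeZero L] {i j a : Fin d}

omit [NeZero L] in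
/-- Continuity of the monomial weights `X^α Y^β`. [folklore] -/
theorem continuous_XYpow (α β : ℕ) :
    Continuous fun U : ZdGaugeConfig d Circle =>
      cosT L (top i j) U ^ α * cosT L (bot i j a) U ^ β :=
  ((continuous_cosT L _).pow α).mul ((continuous_cosT L _).pow β)

omit [NeZero L] in
/-- `|X^α Y^β| ≤ 1`. [folklore] -/
theorem norm_XYpow_le (α β : ℕ) (U : ZdGaugeConfig d Circle) :
    ‖cosT L (top i j) U ^ α * cosT L (bot i j a) U ^ β‖ ≤ 1 := by
  rw [norm_mul, norm_pow, norm_pow, Real.norm_eq_abs, Real.norm_eq_abs]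
  exact mul_le_one₀ (pow_le_one₀ (abs_nonneg _) (abs_cosT_le_one L _ U))
    (by positivity) (pow_le_one₀ (abs_nonneg _) (abs_cosT_le_one L _ U))

omit [NeZero L] in
/-- `|c_q^m| ≤ 1`. [folklore] -/
theorem norm_cosT_pow_le (q : TPlaq d L) (m : ℕ) (U : ZdGaugeConfig d Circle) :
    ‖cosT L q U ^ m‖ ≤ 1 := by
  rw [norm_pow, Real.norm_eq_abs]
  exact pow_le_one₀ (abs_nonneg _) (abs_cosT_le_one L _ U)

/-- `E[c_q^m] = m_m` for a genuine `q` (peel `q` through its first bond, trivial weight). [folklore] -/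
theorem integral_cosT_pow (hL : 2 ≤ L) {q : TPlaq d L} (hq : q.2.1 < q.2.2) (m : ℕ) :
    ∫ U, cosT L q U ^ m ∂(zdHaar d Circle) = ∫ z, ((z : ℂ).re) ^ m ∂(haarProbability Circle) := by
  have hb : ((q.1, q.2.1) : Edge d L) ∈ q.tbonds := by simp [TPlaq.tbonds]
  have h := integral_mul_cosT_pow hL hq hb (G := fun _ => (1 : ℝ)) measurable_const (K := 1)
    (fun _ => by simp) (fun _ _ => rfl) m
  simp only [one_mul, integral_const, probReal_univ, smul_eq_mul] at h
  exact h

/-- **`E[X^α Y^β] = m_α m_β`** (peel `bot` through a bond off `top`, then `top`). [folklore] -/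
theorem integral_X_pow_mul_Y_pow (hL : 3 ≤ L) (hij : i < j) (hai : a ≠ i) (haj : a ≠ j) (α β : ℕ) :
    ∫ U, cosT L (top i j) U ^ α * cosT L (bot i j a) U ^ β ∂(zdHaar d Circle) =
      (∫ z, ((z : ℂ).re) ^ α ∂(haarProbability Circle)) *
        ∫ z, ((z : ℂ).re) ^ β ∂(haarProbability Circle) := by
  have hL2 : 2 ≤ L := by omega
  have hbg : (bot (L := L) i j a).2.1 < (bot (L := L) i j a).2.2 := hij
  have htg : (top (L := L) i j).2.1 < (top (L := L) i j).2.2 := hij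
  have hb : (((bot (L := L) i j a).1, (bot (L := L) i j a).2.1) : Edge d L) ∈
      (bot (L := L) i j a).tbonds := by simp [TPlaq.tbonds]
  have hbT : (((bot (L := L) i j a).1, (bot (L := L) i j a).2.1) : Edge d L) ∉
      (top (L := L) i j).tbonds := fun h =>
    Finset.disjoint_left.1 (disjoint_tbonds_top_bot hL2 hai haj) h hb
  have h1 := integral_mul_cosT_pow hL2 hbg hb (G := fun U => cosT L (top i j) U ^ α)
    (((continuous_cosT L _).pow α).measurable) (K := 1) (norm_cosT_pow_le _ α)
    (fun z U => by simp only [cosT_mulSingle_of_not_mem hbT]) β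
  refine h1.trans ?_
  rw [integral_cosT_pow hL2 htg]

/-- **`E[X^α Y^β c_q] = 0`** for a genuine `q ∉ {top, bot}` (peel `q` through a bond off
`top ∪ bot`; `∫ Re z = 0`). [folklore] -/
theorem integral_XY_pow_mul_cosT (hL : 3 ≤ L) (hij : i < j) (α β : ℕ) {q : TPlaq d L}
    (hq : q.2.1 < q.2.2) (hqT : q ≠ top i j) (hqB : q ≠ bot i j a) :
    ∫ U, cosT L (top i j) U ^ α * cosT L (bot i j a) U ^ β * cosT L q U ∂(zdHaar d Circle) = 0 := by
  have hL2 : 2 ≤ L := by omega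
  have hbg : (bot (L := L) i j a).2.1 < (bot (L := L) i j a).2.2 := hij
  have htg : (top (L := L) i j).2.1 < (top (L := L) i j).2.2 := hij
  obtain ⟨b, hb, hbT, hbB, -⟩ := exists_bond_not_mem_three hL hq htg hbg hbg
    (Ne.symm hqT) (Ne.symm hqB) (Ne.symm hqB)
  have h := integral_mul_cosT_pow hL2 hq hb
    (G := fun U => cosT L (top i j) U ^ α * cosT L (bot i j a) U ^ β)
    ((continuous_XYpow (i := i) (j := j) (a := a) α β).measurable)
    (norm_XYpow_le α β) (fun z U => by
      simp only [cosT_mulSingle_of_not_mem hbT, cosT_mulSingle_of_not_mem hbB]) 1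
  simp only [pow_one] at h
  rw [h, integral_re, mul_zero]

/-- **`E[X^α Y^β c_q²] = m_α m_β / 2`** for a genuine `q ∉ {top, bot}`. [folklore] -/
theorem integral_XY_pow_mul_cosT_sq (hL : 3 ≤ L) (hij : i < j) (hai : a ≠ i) (haj : a ≠ j)
    (α β : ℕ) {q : TPlaq d L} (hq : q.2.1 < q.2.2) (hqT : q ≠ top i j) (hqB : q ≠ bot i j a) :
    ∫ U, cosT L (top i j) U ^ α * cosT L (bot i j a) U ^ β * cosT L q U ^ 2 ∂(zdHaar d Circle) =
      (∫ z, ((z : ℂ).re) ^ α ∂(haarProbability Circle)) *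
        (∫ z, ((z : ℂ).re) ^ β ∂(haarProbability Circle)) / 2 := by
  have hL2 : 2 ≤ L := by omega
  have hbg : (bot (L := L) i j a).2.1 < (bot (L := L) i j a).2.2 := hij
  have htg : (top (L := L) i j).2.1 < (top (L := L) i j).2.2 := hij
  obtain ⟨b, hb, hbT, hbB, -⟩ := exists_bond_not_mem_three hL hq htg hbg hbg
    (Ne.symm hqT) (Ne.symm hqB) (Ne.symm hqB)
  have h := integral_mul_cosT_pow hL2 hq hb
    (G := fun U => cosT L (top i j) U ^ α * cosT L (bot i j a) U ^ β)
    ((continuous_XYpow (i := i) (j := j) (a := a) α β).measurable)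
    (norm_XYpow_le α β) (fun z U => by
      simp only [cosT_mulSingle_of_not_mem hbT, cosT_mulSingle_of_not_mem hbB]) 2
  refine h.trans ?_
  rw [integral_X_pow_mul_Y_pow hL hij hai haj, integral_re_sq]
  ring

/-- **`E[X^α Y^β c_r c_q] = 0`** for distinct genuine `q, r` with `q ∉ {top, bot}` (peel `q`
through a bond off `top ∪ bot ∪ r`). [folklore] -/
theorem integral_XY_pow_mul_cosT_mul_cosT (hL : 3 ≤ L) (hij : i < j) (α β : ℕ) {q r : TPlaq d L}
    (hq : q.2.1 < q.2.2) (hr : r.2.1 < r.2.2) (hqT : q ≠ top i j) (hqB : q ≠ bot i j a)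
    (hqr : q ≠ r) :
    ∫ U, cosT L (top i j) U ^ α * cosT L (bot i j a) U ^ β * cosT L r U * cosT L q U
      ∂(zdHaar d Circle) = 0 := by
  have hL2 : 2 ≤ L := by omega
  have hbg : (bot (L := L) i j a).2.1 < (bot (L := L) i j a).2.2 := hij
  have htg : (top (L := L) i j).2.1 < (top (L := L) i j).2.2 := hij
  obtain ⟨b, hb, hbT, hbB, hbr⟩ := exists_bond_not_mem_three hL hq htg hbg hr
    (Ne.symm hqT) (Ne.symm hqB) (Ne.symm hqr)
  have hm : Measurable fun U : ZdGaugeConfig d Circle =>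
      cosT L (top i j) U ^ α * cosT L (bot i j a) U ^ β * cosT L r U :=
    ((continuous_XYpow (i := i) (j := j) (a := a) α β).mul (continuous_cosT L r)).measurable
  have hbnd : ∀ U : ZdGaugeConfig d Circle,
      ‖cosT L (top i j) U ^ α * cosT L (bot i j a) U ^ β * cosT L r U‖ ≤ 1 := fun U => by
    rw [norm_mul]
    exact mul_le_one₀ (norm_XYpow_le α β U) (norm_nonneg _)
      (by rw [Real.norm_eq_abs]; exact abs_cosT_le_one L r U)
  have h := integral_mul_cosT_pow hL2 hq hb hm hbnd (fun z U => by
      simp only [cosT_mulSingle_of_not_mem hbT, cosT_mulSingle_of_not_mem hbB,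
        cosT_mulSingle_of_not_mem hbr]) 1
  simp only [pow_one] at h
  rw [h, integral_re, mul_zero]

/-- **`E[H · X] = 0`** for every bounded measurable weight `H` unchanged by translating some bond
of `top`. [folklore] -/
theorem integral_mul_X_eq_zero (hL : 2 ≤ L) (hij : i < j) {H : ZdGaugeConfig d Circle → ℝ}
    (hHm : Measurable H) {K : ℝ} (hHb : ∀ U, ‖H U‖ ≤ K) {b : Edge d L}
    (hb : b ∈ (top (L := L) i j).tbonds)
    (hHinv : ∀ z U, H (Pi.mulSingle (torusSect L b) z * U) = H U) :
    ∫ U, H U * cosT L (top i j) U ∂(zdHaar d Circle) = 0 := by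
  have htg : (top (L := L) i j).2.1 < (top (L := L) i j).2.2 := hij
  have h := integral_mul_cosT_pow hL htg hb hHm hHb hHinv 1
  simp only [pow_one] at h
  rw [h, integral_re, mul_zero]

/-- **`E[H · Y] = 0`** likewise for `bot`. [folklore] -/
theorem integral_mul_Y_eq_zero (hL : 2 ≤ L) (hij : i < j) {H : ZdGaugeConfig d Circle → ℝ}
    (hHm : Measurable H) {K : ℝ} (hHb : ∀ U, ‖H U‖ ≤ K) {b : Edge d L}
    (hb : b ∈ (bot (L := L) i j a).tbonds)
    (hHinv : ∀ z U, H (Pi.mulSingle (torusSect L b) z * U) = H U) :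
    ∫ U, H U * cosT L (bot i j a) U ∂(zdHaar d Circle) = 0 := by
  have hbg : (bot (L := L) i j a).2.1 < (bot (L := L) i j a).2.2 := hij
  have h := integral_mul_cosT_pow hL hbg hb hHm hHb hHinv 1
  simp only [pow_one] at h
  rw [h, integral_re, mul_zero]

omit [NeZero L] in
/-- Bound `≤ 1` for a weight `c^γ c_q c_r c_s`. [folklore] -/
theorem norm_pow_mul_three_le (p q r s : TPlaq d L) (γ : ℕ) (U : ZdGaugeConfig d Circle) :
    ‖cosT L p U ^ γ * cosT L q U * cosT L r U * cosT L s U‖ ≤ 1 := by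
  simp only [norm_mul, norm_pow, Real.norm_eq_abs]
  have h1 := abs_cosT_le_one L p U
  have h2 := abs_cosT_le_one L q U
  have h3 := abs_cosT_le_one L r U
  have h4 := abs_cosT_le_one L s U
  have h0 : |cosT L p U| ^ γ ≤ 1 := pow_le_one₀ (abs_nonneg _) h1
  have h2' := abs_nonneg (cosT L q U)
  have h3' := abs_nonneg (cosT L r U)
  have h4' := abs_nonneg (cosT L s U)
  calc |cosT L p U| ^ γ * |cosT L q U| * |cosT L r U| * |cosT L s U|
      ≤ 1 * 1 * 1 * 1 := by gcongr
    _ = 1 := by ring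

/-- **Three other plaquettes leave a bond of `top` uncovered**: `E[Y^β c_q c_r c_s · X] = 0` for
genuine `q, r, s ≠ top`. [folklore] -/
theorem integral_three_mul_X (hL : 3 ≤ L) (hij : i < j) (hai : a ≠ i) (haj : a ≠ j) (β : ℕ)
    {q r s : TPlaq d L} (hq : q.2.1 < q.2.2) (hr : r.2.1 < r.2.2) (hs : s.2.1 < s.2.2)
    (hqT : q ≠ top i j) (hrT : r ≠ top i j) (hsT : s ≠ top i j) :
    ∫ U, cosT L (bot i j a) U ^ β * cosT L q U * cosT L r U * cosT L s U * cosT L (top i j) U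
      ∂(zdHaar d Circle) = 0 := by
  have hL2 : 2 ≤ L := by omega
  have htg : (top (L := L) i j).2.1 < (top (L := L) i j).2.2 := hij
  obtain ⟨b, hb, hbq, hbr, hbs⟩ := exists_bond_not_mem_three hL htg hq hr hs hqT hrT hsT
  have hbB : b ∉ (bot (L := L) i j a).tbonds := fun h =>
    Finset.disjoint_left.1 (disjoint_tbonds_top_bot hL2 hai haj) hb h
  refine integral_mul_X_eq_zero hL2 hij ?_ (K := 1) (norm_pow_mul_three_le _ q r s β) hb ?_
  · exact ((((continuous_cosT L _).pow β).mul (continuous_cosT L q)).mul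
      (continuous_cosT L r) |>.mul (continuous_cosT L s)).measurable
  · intro z U
    simp only [cosT_mulSingle_of_not_mem hbB, cosT_mulSingle_of_not_mem hbq,
      cosT_mulSingle_of_not_mem hbr, cosT_mulSingle_of_not_mem hbs]

/-- **Three other plaquettes leave a bond of `bot` uncovered**: `E[X^α c_q c_r c_s · Y] = 0` for
genuine `q, r, s ≠ bot`. [folklore] -/
theorem integral_three_mul_Y (hL : 3 ≤ L) (hij : i < j) (hai : a ≠ i) (haj : a ≠ j) (α : ℕ)
    {q r s : TPlaq d L} (hq : q.2.1 < q.2.2) (hr : r.2.1 < r.2.2) (hs : s.2.1 < s.2.2)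
    (hqB : q ≠ bot i j a) (hrB : r ≠ bot i j a) (hsB : s ≠ bot i j a) :
    ∫ U, cosT L (top i j) U ^ α * cosT L q U * cosT L r U * cosT L s U * cosT L (bot i j a) U
      ∂(zdHaar d Circle) = 0 := by
  have hL2 : 2 ≤ L := by omega
  have hbg : (bot (L := L) i j a).2.1 < (bot (L := L) i j a).2.2 := hij
  obtain ⟨b, hb, hbq, hbr, hbs⟩ := exists_bond_not_mem_three hL hbg hq hr hs hqB hrB hsB
  have hbT : b ∉ (top (L := L) i j).tbonds := fun h =>
    Finset.disjoint_left.1 (disjoint_tbonds_top_bot hL2 hai haj) h hb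
  refine integral_mul_Y_eq_zero hL2 hij ?_ (K := 1) (norm_pow_mul_three_le _ q r s α) hb ?_
  · exact ((((continuous_cosT L _).pow α).mul (continuous_cosT L q)).mul
      (continuous_cosT L r) |>.mul (continuous_cosT L s)).measurable
  · intro z U
    simp only [cosT_mulSingle_of_not_mem hbT, cosT_mulSingle_of_not_mem hbq,
      cosT_mulSingle_of_not_mem hbr, cosT_mulSingle_of_not_mem hbs]

end Atomic

end Summit.Ventures.LatticeQCDFlow.Theory2.Lattice.U1Torus

end
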